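import Summits.CriticalPhenomena.PercolationContinuityZ3.Theorems.Transplant.SkeletonFrmQuasiCustomersHolds
import Summits.CriticalPhenomena.PercolationContinuityZ3.Theorems.Transplant.TriFilmScope
import HarnessLib

/-!
# The triangular films `𝕋 × {0..k}` die at their own critical points for EVERY `k ≥ 0` (also `k = 0`: the triangular lattice, and `k = 1`)
# — by the doubly-periodic customer of the rung-Q node

builds on p205010 (kernel theorem, internal audit signed; external expert review pending).  Lane `prim-bschramm`, seat `prim-bschramm-stmt`
gen 36 (statements seat; by-name customer of the rung-Q node); helper file (`--supports stmt-CriticalPhenomena-4575 --as helper`); PROOFS ONLY (def-free).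

THE POINT.  The film `𝕋 × {0..k}` of the stacked triangular lattice `𝕋 □ ℤ` (`TriFilm.film k`, «TriFilmHexShadow»/«TriFilmScope») is a DOUBLY PERIODIC
GRAPH: `ℤ²` acts by the lifted planar translations `TriFilm.liftIso k (triShiftIso t)` (identity on the layers), by graph automorphisms, FREELY, with
the `k + 1` orbits of the layer representatives `TriFilm.types k`, and the film is connected for every `k` (`TriFilm.connected`).  The rung-Q node
(«SkelFrmQuasiProxHoldsAll», p553137) through «SkeletonFrmQuasiCustomersHolds» §`AutChart.conj4_zTwoPeriodic_holds` therefore gives, for EVERY `k : ℕ` and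
EVERY vertex `v`: **`p_c(v) < 1` and `θ_v(p_c(v)) = 0`** — `TriFilm.conj4_holds_all`, `TriFilm.theta_criticalProb_eq_zero_all`.  For `k ≥ 2` this is
ALREADY in the tree INDEPENDENTLY OF p205010: p2's `TriFilm.theta_criticalProb_eq_zero (hk : 2 ≤ k)` («TriFilmLinkage», p542416; the hexagonal-shadow
transplant of Duminil-Copin–Sidoravicius–Tassion) — cited, not touched, and the reference proof for `k ≥ 2`; the cases this file ADDS are `k = 1` (two
triangular layers) and `k = 0` (the triangular lattice `𝕋` itself as the one-layer film; for `𝕋` proper, `θ(p_c) = 0` at `p_c = 2 sin(π/18)` is in print,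
Wierman 1981 / Kesten 1982 — not used).  Nothing is claimed about `𝕋 □ ℤ` itself (`StackedTriangularCriticalContinuity`, a different node) or about
Conjecture 4 beyond these periodic instances.
[cite: BenjaminiSchramm1996, Conj. 4 / Question 3; §2 (almost transitive graphs)] [cite: Kesten1982, Ch. 3 (periodic graphs)]
[cite: DuminilCopinSidoraviciusTassion2016, Thm. 1 (slabs ℤ² × {0..k})]
-/

noncomputable section

namespace Summit.CriticalPhenomena.PercolationContinuityZ3.Theorems.Transplant

open SimpleGraph Literature.Barriers.CriticalPhenomena Literature.Probability.LatticeModels Literature.Probability.Percolation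
open scoped Classical

namespace TriFilm

/-- **A lifted planar translation that fixes one vertex of the film is the zero translation** — the `ℤ²`-action on `𝕋 × {0..k}` is FREE. [folklore] -/
theorem liftIso_triShiftIso_apply_eq_self_iff (k : ℕ) (t : Site 2) (x : triFilm k) : liftIso k (triShiftIso t) x = x ↔ t = 0 := by
  constructor
  · intro h
    have h1 := congrArg (fun y : triFilm k => (y : Site 2 × Site 1).1) h
    simp only [liftIso_coe_fst, triShiftIso_apply, add_eq_left] at h1
    exact h1
  · rintro rfl
    apply Subtype.ext
    refine Prod.ext ?_ rfl
    rw [liftIso_coe_fst, triShiftIso_apply, add_zero]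

/-- **Every triangular film `𝕋 × {0..k}`, EVERY `k ≥ 0`, has `p_c < 1` and dies at its own critical point, at every vertex** — from the rung-Q node via
`AutChart.conj4_zTwoPeriodic_holds`: the lifted planar translations form a free `ℤ²`-action by automorphisms with the `k + 1` orbits of `TriFilm.types k`,
and the film is connected.  (For `k ≥ 2` the `θ` half is p2's p205010-independent `TriFilm.theta_criticalProb_eq_zero`, p542416.)
builds on p205010 (kernel theorem, internal audit signed; external expert review pending). [cite: BenjaminiSchramm1996, Conj. 4 / Question 3; §2]
[cite: Kesten1982, Ch. 3 (periodic graphs)] -/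
theorem conj4_holds_all (k : ℕ) (v : triFilm k) : criticalProb (film k) v < 1 ∧ theta (film k) v (criticalProbIOf (film k) v) = 0 := by
  -- the `ℤ²`-action by lifted planar translations (a local instance; no global instance is declared)
  letI inst : MulAction (Multiplicative (Site 2)) (triFilm k) :=
    { smul := fun a x => liftIso k (triShiftIso (Multiplicative.toAdd a)) x
      one_smul := fun x => Subtype.ext (Prod.ext (by
        change (x : Site 2 × Site 1).1 + Multiplicative.toAdd (1 : Multiplicative (Site 2)) = (x : Site 2 × Site 1).1
        rw [toAdd_one, add_zero]) rfl)
      mul_smul := fun a b x => Subtype.ext (Prod.ext (by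
        change (x : Site 2 × Site 1).1 + Multiplicative.toAdd (a * b) = ((x : Site 2 × Site 1).1 + Multiplicative.toAdd b) + Multiplicative.toAdd a
        rw [toAdd_mul, add_assoc, add_comm (Multiplicative.toAdd b)]) rfl) }
  have hact : IsActionByAut (film k) (Multiplicative (Site 2)) := fun a x y => (liftIso k (triShiftIso (Multiplicative.toAdd a))).map_adj_iff
  have hfree : ∀ (a : Multiplicative (Site 2)) (x : triFilm k), a • x = x → a = 1 := fun a x h =>
    Multiplicative.toAdd.injective ((liftIso_triShiftIso_apply_eq_self_iff k _ x).1 h)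
  have hcover : ∀ w : triFilm k, ∃ a : Multiplicative (Site 2), ∃ r ∈ types k, a • r = w := by
    intro w
    have hw := mem_triFilm.1 w.2
    set j : ℕ := ((w : Site 2 × Site 1).2 0).toNat with hj
    have hjk : j < k + 1 := by omega
    have hjw : ((j : ℕ) : ℤ) = (w : Site 2 × Site 1).2 0 := by omega
    refine ⟨Multiplicative.ofAdd (w : Site 2 × Site 1).1, rep k ⟨j, hjk⟩, Finset.mem_image_of_mem _ (Finset.mem_univ _),
      Subtype.ext (Prod.ext ?_ ?_)⟩
    · change ((rep k ⟨j, hjk⟩ : triFilm k) : Site 2 × Site 1).1 + Multiplicative.toAdd (Multiplicative.ofAdd (w : Site 2 × Site 1).1) = _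
      rw [toAdd_ofAdd]; simp [rep]
    · change ((rep k ⟨j, hjk⟩ : triFilm k) : Site 2 × Site 1).2 = (w : Site 2 × Site 1).2
      ext i; fin_cases i
      simp [rep, hjw]
  exact AutChart.conj4_zTwoPeriodic_holds hact hfree (connected k) (types k) hcover v

/-- **`θ_v(p_c) = 0` on the triangular film `𝕋 × {0..k}` for EVERY `k ≥ 0`, at every vertex** (statement shape of p2's `TriFilm.theta_criticalProb_eq_zero`,
without its `2 ≤ k`; new content: `k = 0, 1`).  builds on p205010 (kernel theorem, internal audit signed; external expert review pending).
[cite: BenjaminiSchramm1996, Conj. 4 / Question 3] [cite: DuminilCopinSidoraviciusTassion2016, Thm. 1] -/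
theorem theta_criticalProb_eq_zero_all (k : ℕ) (v : triFilm k) : theta (film k) v (criticalProbIOf (film k) v) = 0 :=
  (conj4_holds_all k v).2

/-- **`p_c(v) < 1` on the triangular film `𝕋 × {0..k}` for every `k ≥ 0`, at every vertex.** builds on p205010 (kernel theorem, internal audit signed;
external expert review pending). [cite: BenjaminiSchramm1996, Thm. 1 / §2] -/
theorem criticalProb_lt_one_all (k : ℕ) (v : triFilm k) : criticalProb (film k) v < 1 :=
  (conj4_holds_all k v).1

end TriFilm

end Summit.CriticalPhenomena.PercolationContinuityZ3.Theorems.Transplant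

end
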